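import Mathlib
import Summits.Ventures.PercRepro2.TB14CutTransfer
import Summits.Ventures.PercRepro2.TypedContract

/-!
# Typed BHK 1.4 at every profile from the all-free profile
(blind cell PercRepro2, mine-c g16, 2026-08-25; `proofs/MINEC-TB14BLOCK.md` §9)

`TB14_of_allFree`: if typed BHK 1.4 for single-vertex events holds at the ALL-FREE profile on every
finite multigraph, then the Prop `A3InactiveTyped.TB14` (every profile) holds.  A pinned-open edge
`g = {u, v}` is contracted (`Contract.contractEnds`, the cell's contraction on the same vertex and
edge types; the two-copy kernels are pointwise equal on the admissible pairs by
`TypedRed.conn_contract_open_iff`, since `g` is open in both copies), which strictly decreases the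
number of non-loop pinned-open edges; when every pinned-open edge is a loop, the count is the
all-free count of the graph on the free edges (`pairCount_eq_free`: a configuration of the free
edges extends by the pinned values, `extendZ`; open loops and closed edges do not change
connectivity, `conn_extendZ_iff`).  Own work; standard axioms.
-/

namespace Summit.Ventures.PercRepro2

namespace TB14Cut

open CovForm A3InactiveTyped Contract

/-! ## A congruence for two-copy counts -/

section Congr

variable {E : Type*} [Fintype E] [DecidableEq E] {R : Type*} [CommRing R]

/-- Kernels agreeing on every admissible pair `(y, A3InactiveTyped.flipOn F y)` have the same count. -/
lemma pairCount_congr_adm (F : Finset E) (z : Config E) (Φ Ψ : Config E → Config E → R)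
    (h : ∀ y : Config E, (∀ e, e ∉ F → y e = z e) → Φ y (A3InactiveTyped.flipOn F y) = Ψ y (A3InactiveTyped.flipOn F y)) :
    pairCount F z Φ = pairCount F z Ψ := by
  unfold pairCount
  refine Finset.sum_congr rfl fun y _ => ?_
  split_ifs with hy
  · exact h y hy
  · rfl

end Congr

/-! ## Contracting a pinned-open edge -/

section Contract

variable {V : Type*} {E : Type*} [DecidableEq V] {R : Type*} [Field R]

/-- `1_{b ∈ C(a)}` with `g = {u, v}` open is the indicator in `H/{u, v}` with the marks mapped. -/
lemma iL_contract_open {ends : E → Sym2 V} {ω : Config E} {g : E} {u v : V}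
    (hg : ends g = s(u, v)) (hω : ω g = true) (a b : V) :
    (iL ends a b ω : R) =
      iL (contractEnds ends {u, v} u) (contractMap {u, v} u a) (contractMap {u, v} u b) ω := by
  classical
  rw [iL_eq_ite', iL_eq_ite', TypedRed.conn_contract_open_iff hg hω]

/-- `1_{b ∈ C(a)}` (second root) with `g = {u, v}` open, in `H/{u, v}`. -/
lemma iH_contract_open {ends : E → Sym2 V} {ω : Config E} {g : E} {u v : V}
    (hg : ends g = s(u, v)) (hω : ω g = true) (a b : V) :
    (iH ends a b ω : R) =
      iH (contractEnds ends {u, v} u) (contractMap {u, v} u a) (contractMap {u, v} u b) ω := by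
  classical
  rw [iH_eq_ite', iH_eq_ite', TypedRed.conn_contract_open_iff hg hω]

/-- `1_Q` with `g = {u, v}` open, in `H/{u, v}`. -/
lemma iQ_contract_open {ends : E → Sym2 V} {ω : Config E} {g : E} {u v : V}
    (hg : ends g = s(u, v)) (hω : ω g = true) (a₁ a₂ : V) :
    (iQ ends a₁ a₂ ω : R) =
      iQ (contractEnds ends {u, v} u) (contractMap {u, v} u a₁) (contractMap {u, v} u a₂) ω := by
  classical
  rw [iQ_eq_ite', iQ_eq_ite', TypedRed.conn_contract_open_iff hg hω]

/-- The «same» kernel with `g` open in both copies is the kernel of `H/{u, v}`. -/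
lemma sameBO_contract_open {ends : E → Sym2 V} {g : E} {u v : V} (hg : ends g = s(u, v))
    {y w : Config E} (hy : y g = true) (hw : w g = true) (a₁ a₂ b o : V) :
    (sameBO ends a₁ a₂ b o y w : R) =
      sameBO (contractEnds ends {u, v} u) (contractMap {u, v} u a₁) (contractMap {u, v} u a₂)
        (contractMap {u, v} u b) (contractMap {u, v} u o) y w := by
  unfold sameBO
  rw [iQ_contract_open hg hy a₁ a₂, iL_contract_open hg hy a₁ b, iH_contract_open hg hy a₂ o,
    iQ_contract_open hg hw a₁ a₂]

/-- The «cross» kernel with `g` open in both copies is the kernel of `H/{u, v}`. -/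
lemma crossBO_contract_open {ends : E → Sym2 V} {g : E} {u v : V} (hg : ends g = s(u, v))
    {y w : Config E} (hy : y g = true) (hw : w g = true) (a₁ a₂ b o : V) :
    (crossBO ends a₁ a₂ b o y w : R) =
      crossBO (contractEnds ends {u, v} u) (contractMap {u, v} u a₁) (contractMap {u, v} u a₂)
        (contractMap {u, v} u b) (contractMap {u, v} u o) y w := by
  unfold crossBO
  rw [iQ_contract_open hg hy a₁ a₂, iH_contract_open hg hy a₂ o, iQ_contract_open hg hw a₁ a₂,
    iL_contract_open hg hw a₁ b]

/-- Contraction keeps loops. -/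
lemma isDiag_contractEnds_of_isDiag (ends : E → Sym2 V) (W : Finset V) (w₀ : V) {e : E}
    (h : (ends e).IsDiag) : (contractEnds ends W w₀ e).IsDiag := by
  rw [contractEnds_apply]
  obtain ⟨⟨p, q⟩, hpq⟩ := Quot.exists_rep (ends e)
  have hpq' : ends e = s(p, q) := hpq.symm
  rw [hpq'] at h ⊢
  rw [Sym2.mk_isDiag_iff] at h
  rw [Sym2.map_mk, Sym2.mk_isDiag_iff, h]

/-- The contracted edge becomes a loop. -/
lemma isDiag_contractEnds_self (ends : E → Sym2 V) {g : E} {u v : V} (hg : ends g = s(u, v)) :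
    (contractEnds ends {u, v} u g).IsDiag := by
  rw [contractEnds_apply, hg, Sym2.map_mk, Sym2.mk_isDiag_iff,
    contractMap_of_mem (by simp), contractMap_of_mem (by simp)]

variable [Fintype E] [DecidableEq E]

/-- **Contracting a pinned-open edge** (the «same» count). -/
theorem pairCount_sameBO_contract_open (ends : E → Sym2 V) {g : E} {u v : V}
    (hg : ends g = s(u, v)) (F : Finset E) (hgF : g ∉ F) (z : Config E) (hz : z g = true)
    (a₁ a₂ b o : V) :
    pairCount F z (sameBO ends a₁ a₂ b o : Config E → Config E → R) =
      pairCount F z (sameBO (contractEnds ends {u, v} u) (contractMap {u, v} u a₁)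
        (contractMap {u, v} u a₂) (contractMap {u, v} u b) (contractMap {u, v} u o)) := by
  refine pairCount_congr_adm F z _ _ fun y hy => ?_
  have hyg : y g = true := (hy g hgF).trans hz
  have hwg : A3InactiveTyped.flipOn F y g = true := by rw [A3InactiveTyped.flipOn_of_notMem hgF]; exact hyg
  exact sameBO_contract_open hg hyg hwg a₁ a₂ b o

/-- **Contracting a pinned-open edge** (the «cross» count). -/
theorem pairCount_crossBO_contract_open (ends : E → Sym2 V) {g : E} {u v : V}
    (hg : ends g = s(u, v)) (F : Finset E) (hgF : g ∉ F) (z : Config E) (hz : z g = true)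
    (a₁ a₂ b o : V) :
    pairCount F z (crossBO ends a₁ a₂ b o : Config E → Config E → R) =
      pairCount F z (crossBO (contractEnds ends {u, v} u) (contractMap {u, v} u a₁)
        (contractMap {u, v} u a₂) (contractMap {u, v} u b) (contractMap {u, v} u o)) := by
  refine pairCount_congr_adm F z _ _ fun y hy => ?_
  have hyg : y g = true := (hy g hgF).trans hz
  have hwg : A3InactiveTyped.flipOn F y g = true := by rw [A3InactiveTyped.flipOn_of_notMem hgF]; exact hyg
  exact crossBO_contract_open hg hyg hwg a₁ a₂ b o

end Contract

/-! ## When every pinned-open edge is a loop: the all-free count of the free edges -/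

section Free

variable {V : Type*} {E : Type*} [DecidableEq E] (F : Finset E) (z : Config E)

/-- Extend a configuration of the free edges by the pinned values. -/
def extendZ (u : Config {e // e ∈ F}) : Config E := fun e => if h : e ∈ F then u ⟨e, h⟩ else z e

/-- The restriction of a configuration to the free edges. -/
def toFree (y : Config E) : Config {e // e ∈ F} := fun e => y e.1

/-- The graph on the free edges. -/
def freeEnds (ends : E → Sym2 V) : {e // e ∈ F} → Sym2 V := fun e => ends e.1

/-- `extendZ` on a free edge. -/
lemma extendZ_of_mem (u : Config {e // e ∈ F}) {e : E} (h : e ∈ F) : extendZ F z u e = u ⟨e, h⟩ :=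
  dif_pos h

/-- `extendZ` on a pinned edge. -/
lemma extendZ_of_notMem (u : Config {e // e ∈ F}) {e : E} (h : e ∉ F) : extendZ F z u e = z e :=
  dif_neg h

/-- `toFree` after `extendZ`. -/
lemma toFree_extendZ (u : Config {e // e ∈ F}) : toFree F (extendZ F z u) = u := by
  funext e
  simp only [toFree]
  rw [extendZ_of_mem F z u e.2]

/-- `extendZ` after `toFree` on an admissible configuration. -/
lemma extendZ_toFree {y : Config E} (hy : ∀ e, e ∉ F → y e = z e) :
    extendZ F z (toFree F y) = y := by
  funext e
  by_cases h : e ∈ F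
  · rw [extendZ_of_mem F z _ h]
    rfl
  · rw [extendZ_of_notMem F z _ h, hy e h]

/-- The second copy of an extension is the extension of the second copy. -/
lemma flipOn_extendZ (u : Config {e // e ∈ F}) :
    A3InactiveTyped.flipOn F (extendZ F z u) = extendZ F z (A3InactiveTyped.flipOn Finset.univ u) := by
  funext e
  by_cases h : e ∈ F
  · rw [A3InactiveTyped.flipOn_of_mem h, extendZ_of_mem F z _ h, extendZ_of_mem F z _ h,
      A3InactiveTyped.flipOn_of_mem (Finset.mem_univ _)]
  · rw [A3InactiveTyped.flipOn_of_notMem h, extendZ_of_notMem F z _ h, extendZ_of_notMem F z _ h]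

variable (ends : E → Sym2 V)

/-- **Connections transfer** when every pinned-open edge is a loop: `x ↔ y` in the extension iff
`x ↔ y` in the graph on the free edges. -/
lemma conn_extendZ_iff (hz : ∀ e, e ∉ F → z e = true → (ends e).IsDiag) (u : Config {e // e ∈ F})
    (x y : V) : Conn ends (extendZ F z u) x y ↔ Conn (freeEnds F ends) u x y := by
  constructor
  · intro h
    refine mem_of_conn_of_closed (S := {w | Conn (freeEnds F ends) u x w}) ?_ (conn_refl _ _ x) h
    intro a ha w haw
    obtain ⟨hne, e, he, hends⟩ := openGraph_adj.1 haw
    by_cases heF : e ∈ F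
    · rw [extendZ_of_mem F z u heF] at he
      exact conn_trans ha (conn_of_openAdj ⟨⟨e, heF⟩, he, hends⟩)
    · rw [extendZ_of_notMem F z u heF] at he
      have hd := hz e heF he
      rw [hends, Sym2.mk_isDiag_iff] at hd
      exact absurd hd hne
  · intro h
    refine mem_of_conn_of_closed (S := {w | Conn ends (extendZ F z u) x w}) ?_ (conn_refl _ _ x) h
    intro a ha w haw
    obtain ⟨_, e, he, hends⟩ := openGraph_adj.1 haw
    refine conn_trans ha (conn_of_openAdj ⟨e.1, ?_, hends⟩)
    rw [extendZ_of_mem F z u e.2]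
    exact he

variable {R : Type*} [Field R]

/-- The connection indicator transfers to the free graph. -/
lemma iL_extendZ (hz : ∀ e, e ∉ F → z e = true → (ends e).IsDiag) (u : Config {e // e ∈ F})
    (a v : V) : (iL ends a v (extendZ F z u) : R) = iL (freeEnds F ends) a v u := by
  classical
  rw [iL_eq_ite', iL_eq_ite', conn_extendZ_iff F z ends hz]

/-- The connection indicator (second root) transfers to the free graph. -/
lemma iH_extendZ (hz : ∀ e, e ∉ F → z e = true → (ends e).IsDiag) (u : Config {e // e ∈ F})
    (a v : V) : (iH ends a v (extendZ F z u) : R) = iH (freeEnds F ends) a v u := by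
  classical
  rw [iH_eq_ite', iH_eq_ite', conn_extendZ_iff F z ends hz]

/-- The separation indicator transfers to the free graph. -/
lemma iQ_extendZ (hz : ∀ e, e ∉ F → z e = true → (ends e).IsDiag) (u : Config {e // e ∈ F})
    (a₁ a₂ : V) : (iQ ends a₁ a₂ (extendZ F z u) : R) = iQ (freeEnds F ends) a₁ a₂ u := by
  classical
  rw [iQ_eq_ite', iQ_eq_ite', conn_extendZ_iff F z ends hz]

/-- The «same» kernel transfers to the free graph. -/
lemma sameBO_extendZ (hz : ∀ e, e ∉ F → z e = true → (ends e).IsDiag)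
    (u w : Config {e // e ∈ F}) (a₁ a₂ b o : V) :
    (sameBO ends a₁ a₂ b o (extendZ F z u) (extendZ F z w) : R) =
      sameBO (freeEnds F ends) a₁ a₂ b o u w := by
  simp only [sameBO, iQ_extendZ F z ends hz, iL_extendZ F z ends hz, iH_extendZ F z ends hz]

/-- The «cross» kernel transfers to the free graph. -/
lemma crossBO_extendZ (hz : ∀ e, e ∉ F → z e = true → (ends e).IsDiag)
    (u w : Config {e // e ∈ F}) (a₁ a₂ b o : V) :
    (crossBO ends a₁ a₂ b o (extendZ F z u) (extendZ F z w) : R) =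
      crossBO (freeEnds F ends) a₁ a₂ b o u w := by
  simp only [crossBO, iQ_extendZ F z ends hz, iL_extendZ F z ends hz, iH_extendZ F z ends hz]

variable [Fintype E]

/-- **The count at a profile whose pinned-open edges are loops is the all-free count of the
graph on the free edges.** -/
theorem pairCount_eq_free (Φ : Config E → Config E → R) :
    pairCount F z Φ =
      pairCount (Finset.univ : Finset {e // e ∈ F}) (fun _ => false)
        (fun u w => Φ (extendZ F z u) (extendZ F z w)) := by
  unfold pairCount
  have hadm : ∀ u : Config {e // e ∈ F}, (∀ e, e ∉ (Finset.univ : Finset {e // e ∈ F}) →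
      u e = false) := fun u e he => absurd (Finset.mem_univ e) he
  rw [← Finset.sum_filter]
  symm
  refine Finset.sum_nbij' (fun u => extendZ F z u) (fun y => toFree F y) ?_ ?_ ?_ ?_ ?_
  · intro u _
    rw [Finset.mem_filter]
    exact ⟨Finset.mem_univ _, fun e he => extendZ_of_notMem F z u he⟩
  · intro y _
    exact Finset.mem_univ _
  · intro u _
    exact toFree_extendZ F z u
  · intro y hy
    exact extendZ_toFree F z (Finset.mem_filter.1 hy).2
  · intro u _
    rw [if_pos (hadm u)]
    show Φ (extendZ F z u) (extendZ F z (A3InactiveTyped.flipOn Finset.univ u)) =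
      Φ (extendZ F z u) (A3InactiveTyped.flipOn F (extendZ F z u))
    rw [flipOn_extendZ]

end Free

/-! ## The reduction -/

section Main

variable (R : Type*) [Field R] [LinearOrder R]

/-- The induction on the number of non-loop pinned-open edges (`V`, `E`, `F`, `z` fixed; the
graph and the marks change by contraction). -/
theorem tb14_profile_aux {V E : Type} [Fintype V] [DecidableEq V] [Fintype E] [DecidableEq E]
    (H : ∀ (V E : Type) [Fintype E] [DecidableEq E] (ends : E → Sym2 V) (a₁ a₂ b o : V),
      pairCount Finset.univ (fun _ => false) (sameBO ends a₁ a₂ b o : Config E → Config E → R) ≤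
        pairCount Finset.univ (fun _ => false) (crossBO ends a₁ a₂ b o))
    (F : Finset E) (z : Config E) (n : ℕ) :
    ∀ (ends : E → Sym2 V) (a₁ a₂ b o : V),
      (Finset.univ.filter (fun g => g ∉ F ∧ z g = true ∧ ¬ (ends g).IsDiag)).card = n →
      pairCount F z (sameBO ends a₁ a₂ b o : Config E → Config E → R) ≤
        pairCount F z (crossBO ends a₁ a₂ b o) := by
  induction n using Nat.strong_induction_on with
  | _ n ih =>
  intro ends a₁ a₂ b o hn
  by_cases hex : ∃ g, g ∉ F ∧ z g = true ∧ ¬ (ends g).IsDiag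
  · obtain ⟨g, hgF, hzg, hgd⟩ := hex
    obtain ⟨⟨u, v⟩, huv⟩ := Quot.exists_rep (ends g)
    have hg : ends g = s(u, v) := huv.symm
    rw [pairCount_sameBO_contract_open ends hg F hgF z hzg,
      pairCount_crossBO_contract_open ends hg F hgF z hzg]
    -- the contracted graph has strictly fewer non-loop pinned-open edges
    have hsub : (Finset.univ.filter
        (fun e => e ∉ F ∧ z e = true ∧ ¬ (contractEnds ends {u, v} u e).IsDiag)) ⊂
        Finset.univ.filter (fun e => e ∉ F ∧ z e = true ∧ ¬ (ends e).IsDiag) := by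
      rw [Finset.ssubset_iff_subset_ne]
      refine ⟨fun e he => ?_, fun heq => ?_⟩
      · rw [Finset.mem_filter] at he ⊢
        exact ⟨he.1, he.2.1, he.2.2.1, fun hd => he.2.2.2 (isDiag_contractEnds_of_isDiag ends _ _ hd)⟩
      · have hg' : g ∈ Finset.univ.filter (fun e => e ∉ F ∧ z e = true ∧ ¬ (ends e).IsDiag) :=
          Finset.mem_filter.2 ⟨Finset.mem_univ _, hgF, hzg, hgd⟩
        rw [← heq, Finset.mem_filter] at hg'
        exact hg'.2.2.2 (isDiag_contractEnds_self ends hg)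
    have hlt := Finset.card_lt_card hsub
    rw [hn] at hlt
    exact ih _ hlt _ _ _ _ _ rfl
  · have hz : ∀ e, e ∉ F → z e = true → (ends e).IsDiag :=
      fun e he hze => by_contra fun hd => hex ⟨e, he, hze, hd⟩
    rw [pairCount_eq_free F z (sameBO ends a₁ a₂ b o), pairCount_eq_free F z (crossBO ends a₁ a₂ b o)]
    simp only [sameBO_extendZ F z ends hz, crossBO_extendZ F z ends hz]
    exact H V {e // e ∈ F} (freeEnds F ends) a₁ a₂ b o

/-- **Typed BHK 1.4 at every profile follows from the all-free profile** (THEOREM): if the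
single-vertex typed BHK 1.4 inequality holds at the all-free profile on every finite multigraph,
then the Prop `TB14` — every finite multigraph, every profile `(F, z)`, every roots and marks —
holds.  Pinned-open edges are contracted one at a time; pinned-closed edges and pinned-open loops
are invisible to the two-copy count. -/
theorem TB14_of_allFree
    (H : ∀ (V E : Type) [Fintype E] [DecidableEq E] (ends : E → Sym2 V) (a₁ a₂ b o : V),
      pairCount Finset.univ (fun _ => false) (sameBO ends a₁ a₂ b o : Config E → Config E → R) ≤
        pairCount Finset.univ (fun _ => false) (crossBO ends a₁ a₂ b o)) :
    TB14 R :=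
  fun _ _ _ _ _ _ ends a₁ a₂ b o F z => tb14_profile_aux R H F z _ ends a₁ a₂ b o rfl

end Main

end TB14Cut

end Summit.Ventures.PercRepro2
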